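import Summits.ValiantsHypothesis.ValiantsHypothesis.Theorems.LacunarySymmetroidMatrixDescartesDoorA26WallBubblingThreePairFrame
import Summits.ValiantsHypothesis.ValiantsHypothesis.Theorems.LacunarySymmetroidMatrixDescartesDoorA26WallBubblingDoublyConfluentNondeg

/-!
# Wall bubbling for `DoorA26` — THREE WEYL PAIRS: NON-DEGENERACY of the Gram-normalised limit BY INERTIA

LINE / STUBS.  Crux `Theses.LacunarySymmetroid.DoorA26` (stmt-ValiantsHypothesis-19979; OPEN, typed, never asserted), line
`Cruxes/DoorA26/Lines/wall_bubbling.lean` (val-idea-15), obligation (W) `Stmt.stub_weylFaces`; statement file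
`Cruxes/DoorA26/Lines/wall_bubbling_ConfluentDoor.lean` rev 4, stratum `Stmt.weylFaces_deepVal` with THREE Weyl pairs (`δ₀ = δ₅ = e₀`, `δ₁ = δ₄ = e₁`,
`δ₂ = δ₃ = e₂`, three distinct values with no mixed relation).  Seat val-sym-door-p2 g13 (W1 #32); the three-pair companion of W1 #26.

THE POINT.  In the three-dslope frame (W1 #31) the slot functions have THREE coincidences `φ₀φ₄ = φ₅φ₁`, `φ₀φ₃ = φ₅φ₂`, `φ₁φ₃ = φ₄φ₂` (one per pair of
pairs), so a realisable non-zero limit Gram gives the zero function iff it is `x(E₀₄−E₁₅) + y(E₀₃−E₂₅) + z(E₁₃−E₂₄)` (symmetrised); the letter blocks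
`{0,1,4,5}`, `{0,2,3,5}`, `{1,2,3,4}` isolate `x`, `y`, `z` as disjoint patterns — NOT realisable (W1 #13).  Hence (def-free):

* `threePair_classSums_of_det_zero` — the three-dslope master lemma (slot-class sums of the polar Gram vanish when the three-pair determinant
  vanishes identically; integer model `vv`, degree `d = ![0,0,0,1,1,1]`);
* `threeVG_model (v = ![0,1,3])`, `threePair_lonely`, `threePair_special04_iff`, `threePair_special03_iff`, `threePair_special13_iff` (`decide`);
* **`threePairDet_ne_zero_of_polar_ne_zero`** — at a value-generic three-Weyl-pair point a symmetric frame with one non-zero polar Gram entry has a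
  three-pair confluent determinant that is NOT identically zero.

Nothing in this file bears on (W)/(M)/(R) themselves, on `DoorA26`, on `MatrixDescartes` (stmt-ValiantsHypothesis-18050) or on `VP ≠ VNP`;
registers unchanged.  `--supports stmt-ValiantsHypothesis-19979 --as helper`.  [this work] the inertia argument for the three coinciding slots.
-/

-- `Summit.ValiantsHypothesis.ValiantsHypothesis.…` repeats a component by the D-0017 layout
-- (single-conjunct summit), which the `dupNamespace` linter flags; the name is mandated.
set_option linter.dupNamespace false

namespace Summit.ValiantsHypothesis.ValiantsHypothesis.Theorems.LacunarySymmetroidMatrixDescartes.WallBubbling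

open Finset Filter Topology Polynomial
open Bubbling (polar polar_comm polar_self extSum_card_zeros_le realisable_polarGram realisable_smul Realisable)
open SecondOrder (not_realisable_disjointPattern realisable_blockRestrict_smul)
open scoped BigOperators

/-! ## 1. Class sums (three-dslope master lemma) -/

/-- **CLASS SUMS, three Weyl pairs.**  Positions: pairs at `0,5`, `1,4`, `2,3` (`δ0 5 = δ0 0`, `δ0 4 = δ0 1`, `δ0 3 = δ0 2`); `d` the confluent degree.
If the pair-sum coincidences of the six frame exponents are modelled by `vv` and the three-pair confluent determinant of `W` vanishes identically, every
SLOT-CLASS SUM of the polar Gram vanishes. [this work] -/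
theorem threePair_classSums_of_det_zero (δ0 : Fin 6 → ℝ) (h50 : δ0 5 = δ0 0) (h41 : δ0 4 = δ0 1) (h32 : δ0 3 = δ0 2)
    (vv : Fin 6 → ℕ) (hv : ∀ p q p₀ q₀ : Fin 6, δ0 p + δ0 q = δ0 p₀ + δ0 q₀ ↔ vv p + vv q = vv p₀ + vv q₀)
    (d : Fin 6 → ℕ) (hd : d = ![0, 0, 0, 1, 1, 1])
    (W : Fin 6 → Matrix (Fin 2) (Fin 2) ℝ)
    (hall : ∀ t : ℝ, ((Real.exp (δ0 0 * t)) • (W 0 + t • W 5) + (Real.exp (δ0 1 * t)) • (W 1 + t • W 4)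
        + (Real.exp (δ0 2 * t)) • (W 2 + t • W 3)).det = 0) :
    ∀ p₀ q₀ : Fin 6, (∑ p : Fin 6, ∑ q : Fin 6,
      if (vv p + vv q = vv p₀ + vv q₀ ∧ d p + d q = d p₀ + d q₀) then polar (W p) (W q) else 0) = 0 := by
  classical
  have hdg5 : d 5 = 1 := by rw [hd]; decide
  have hdg4 : d 4 = 1 := by rw [hd]; decide
  have hdg3 : d 3 = 1 := by rw [hd]; decide
  have hdglt : ∀ l : Fin 6, l ≠ 5 → l ≠ 4 → l ≠ 3 → d l = 0 := by rw [hd]; decide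
  -- the slot function of a frame position
  have hslot : ∀ (p : Fin 6) (t : ℝ), (if p = 5 then dslope (fun y : ℝ => Real.exp (y * t)) (δ0 0) (δ0 0)
      else if p = 4 then dslope (fun y : ℝ => Real.exp (y * t)) (δ0 1) (δ0 1)
      else if p = 3 then dslope (fun y : ℝ => Real.exp (y * t)) (δ0 2) (δ0 2) else Real.exp (δ0 p * t))
        = t ^ d p * Real.exp (δ0 p * t) := by
    intro p t
    by_cases hp5 : p = 5
    · subst hp5; rw [if_pos rfl, dslope_exp_same, hdg5, pow_one, h50]
    · by_cases hp4 : p = 4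
      · subst hp4
        rw [if_neg hp5, if_pos rfl, dslope_exp_same, hdg4, pow_one, h41]
      · by_cases hp3 : p = 3
        · subst hp3
          rw [if_neg hp5, if_neg hp4, if_pos rfl, dslope_exp_same, hdg3, pow_one, h32]
        · rw [if_neg hp5, if_neg hp4, if_neg hp3, hdglt p hp5 hp4 hp3, pow_zero, one_mul]
  -- pair sums and the slot polynomials
  set F : Finset ℝ := (univ : Finset (Fin 6 × Fin 6)).image (fun pr => δ0 pr.1 + δ0 pr.2) with hF
  have hmemF : ∀ p q : Fin 6, δ0 p + δ0 q ∈ F := fun p q =>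
    Finset.mem_image.mpr ⟨(p, q), Finset.mem_univ _, rfl⟩
  set P : ℝ → ℝ[X] := fun w => ∑ p : Fin 6, ∑ q : Fin 6,
    if δ0 p + δ0 q = w then C (polar (W p) (W q)) * X ^ (d p + d q) else 0 with hP
  -- (a) the extended sum is the three-pair determinant, hence vanishes identically
  have hrep : ∀ t : ℝ, ∑ w ∈ F, (P w).eval t * Real.exp (w * t) = 0 := by
    intro t
    have hlim := hall t
    rw [threePairDet_eq_quadForm] at hlim
    rw [← hlim]
    have h1 : ∀ w ∈ F, (P w).eval t * Real.exp (w * t)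
        = ∑ p : Fin 6, ∑ q : Fin 6, if δ0 p + δ0 q = w then
            polar (W p) (W q) * t ^ (d p + d q) * Real.exp (w * t) else 0 := by
      intro w _
      rw [hP]
      simp only [eval_finsetSum, Finset.sum_mul]
      refine Finset.sum_congr rfl fun p _ => Finset.sum_congr rfl fun q _ => ?_
      by_cases hval : δ0 p + δ0 q = w
      · rw [if_pos hval, if_pos hval, eval_mul, eval_C, eval_pow, eval_X]
      · rw [if_neg hval, if_neg hval, eval_zero, zero_mul]
    rw [Finset.sum_congr rfl h1, Finset.sum_comm]
    refine Finset.sum_congr rfl fun p _ => ?_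
    rw [Finset.sum_comm]
    refine Finset.sum_congr rfl fun q _ => ?_
    rw [Finset.sum_ite_eq F (δ0 p + δ0 q), if_pos (hmemF p q), hslot p t, hslot q t]
    rw [show (δ0 p + δ0 q) * t = δ0 p * t + δ0 q * t by ring, Real.exp_add, pow_add]
    ring
  -- (b) a crude slot bound: every slot polynomial has degree ≤ 2
  have hdgle : ∀ l : Fin 6, d l ≤ 1 := by rw [hd]; decide
  have hdegP : ∀ w, (P w).natDegree ≤ 2 := by
    intro w
    rw [hP]
    refine natDegree_sum_le_of_forall_le _ _ fun p _ => natDegree_sum_le_of_forall_le _ _ fun q _ => ?_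
    by_cases hval : δ0 p + δ0 q = w
    · rw [if_pos hval]
      refine (natDegree_C_mul_X_pow_le _ _).trans ?_
      have := hdgle p; have := hdgle q; omega
    · rw [if_neg hval, natDegree_zero]; exact Nat.zero_le _
  -- (c) hence EVERY slot polynomial vanishes
  have hPzero : ∀ w ∈ F, P w = 0 := by
    by_contra hne
    push Not at hne
    have hslots : (∑ w ∈ F, if P w = 0 then 0 else (P w).natDegree + 1) ≤ 3 * F.card + 1 := by
      have h1 : (∑ w ∈ F, if P w = 0 then 0 else (P w).natDegree + 1) ≤ ∑ w ∈ F, 3 := by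
        refine Finset.sum_le_sum fun w _ => ?_
        have := hdegP w
        split_ifs <;> omega
      rw [Finset.sum_const, smul_eq_mul] at h1
      linarith [h1]
    set Z : Finset ℝ := (Finset.range (3 * F.card + 1)).image (fun i : ℕ => (i : ℝ)) with hZ
    have hZcard : Z.card = 3 * F.card + 1 := by
      rw [hZ, Finset.card_image_of_injective _ Nat.cast_injective, Finset.card_range]
    have hle := extSum_card_zeros_le (3 * F.card) F P hne hslots Z (fun z _ => hrep z)
    omega
  -- (d) class sums
  intro p₀ q₀
  have hcoeff : (P (δ0 p₀ + δ0 q₀)).coeff (d p₀ + d q₀)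
      = ∑ p : Fin 6, ∑ q : Fin 6, if (δ0 p + δ0 q = δ0 p₀ + δ0 q₀ ∧ d p + d q = d p₀ + d q₀)
          then polar (W p) (W q) else 0 := by
    rw [hP]
    simp only [finsetSum_coeff]
    refine Finset.sum_congr rfl fun p _ => Finset.sum_congr rfl fun q _ => ?_
    by_cases hval : δ0 p + δ0 q = δ0 p₀ + δ0 q₀
    · rw [if_pos hval, coeff_C_mul_X_pow]
      by_cases hdeq : d p₀ + d q₀ = d p + d q
      · rw [if_pos hdeq, if_pos ⟨hval, hdeq.symm⟩]
      · rw [if_neg hdeq, if_neg (fun h => hdeq h.2.symm)]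
    · rw [if_neg hval, coeff_zero, if_neg (fun h => hval h.1)]
  have h0 : (P (δ0 p₀ + δ0 q₀)).coeff (d p₀ + d q₀) = 0 := by rw [hPzero _ (hmemF p₀ q₀), coeff_zero]
  rw [hcoeff] at h0
  refine Eq.trans ?_ h0
  refine Finset.sum_congr rfl fun p _ => Finset.sum_congr rfl fun q _ => ?_
  exact if_congr (by rw [hv]) rfl rfl

/-! ## 2. Slot bookkeeping at a value-generic three-Weyl-pair point (integer model, decidable keys) -/

/-- **Integer model of three value-generic values** (`decide`): for `v = ![0,1,3]`, `v a + v b = v c + v e` iff the pairs agree. [folklore] -/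
theorem threeVG_model (v : Fin 3 → ℕ) (hvd : v = ![0, 1, 3]) :
    ∀ a b c e : Fin 3, v a + v b = v c + v e ↔ ((a = c ∧ b = e) ∨ (a = e ∧ b = c)) := by
  subst hvd
  decide

/-- **Lonely classes at three Weyl pairs** (`decide`): with the model `vv = ![0,1,3,3,1,0]` and the degree `d = ![0,0,0,1,1,1]`, every slot class
outside the twelve special ordered pairs is a single unordered frame pair. [this work] -/
theorem threePair_lonely (vv : Fin 6 → ℕ) (hvv : vv = ![0, 1, 3, 3, 1, 0]) (d : Fin 6 → ℕ) (hd : d = ![0, 0, 0, 1, 1, 1]) :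
    ∀ p q p₀ q₀ : Fin 6, (vv p + vv q = vv p₀ + vv q₀ ∧ d p + d q = d p₀ + d q₀) →
      ¬ ((p₀ = 0 ∧ q₀ = 4) ∨ (p₀ = 4 ∧ q₀ = 0) ∨ (p₀ = 1 ∧ q₀ = 5) ∨ (p₀ = 5 ∧ q₀ = 1) ∨
          (p₀ = 0 ∧ q₀ = 3) ∨ (p₀ = 3 ∧ q₀ = 0) ∨ (p₀ = 2 ∧ q₀ = 5) ∨ (p₀ = 5 ∧ q₀ = 2) ∨
          (p₀ = 1 ∧ q₀ = 3) ∨ (p₀ = 3 ∧ q₀ = 1) ∨ (p₀ = 2 ∧ q₀ = 4) ∨ (p₀ = 4 ∧ q₀ = 2)) →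
      (p = p₀ ∧ q = q₀) ∨ (p = q₀ ∧ q = p₀) := by
  subst hvv hd
  intro p q p₀ q₀
  revert p q
  fin_cases p₀ <;> fin_cases q₀ <;> decide

/-- The model class of `(0,4)` at three Weyl pairs (`decide`). [this work] -/
theorem threePair_special04_iff (vv : Fin 6 → ℕ) (hvv : vv = ![0, 1, 3, 3, 1, 0]) (d : Fin 6 → ℕ) (hd : d = ![0, 0, 0, 1, 1, 1]) :
    ∀ p q : Fin 6, ((vv p + vv q = vv 0 + vv 4 ∧ d p + d q = d 0 + d 4) ↔
        ((p = 0 ∧ q = 4) ∨ (p = 4 ∧ q = 0) ∨ (p = 1 ∧ q = 5) ∨ (p = 5 ∧ q = 1))) := by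
  subst hvv hd
  decide

/-- The model class of `(0,3)` at three Weyl pairs (`decide`). [this work] -/
theorem threePair_special03_iff (vv : Fin 6 → ℕ) (hvv : vv = ![0, 1, 3, 3, 1, 0]) (d : Fin 6 → ℕ) (hd : d = ![0, 0, 0, 1, 1, 1]) :
    ∀ p q : Fin 6, ((vv p + vv q = vv 0 + vv 3 ∧ d p + d q = d 0 + d 3) ↔
        ((p = 0 ∧ q = 3) ∨ (p = 3 ∧ q = 0) ∨ (p = 2 ∧ q = 5) ∨ (p = 5 ∧ q = 2))) := by
  subst hvv hd
  decide

/-- The model class of `(1,3)` at three Weyl pairs (`decide`). [this work] -/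
theorem threePair_special13_iff (vv : Fin 6 → ℕ) (hvv : vv = ![0, 1, 3, 3, 1, 0]) (d : Fin 6 → ℕ) (hd : d = ![0, 0, 0, 1, 1, 1]) :
    ∀ p q : Fin 6, ((vv p + vv q = vv 1 + vv 3 ∧ d p + d q = d 1 + d 3) ↔
        ((p = 1 ∧ q = 3) ∨ (p = 3 ∧ q = 1) ∨ (p = 2 ∧ q = 4) ∨ (p = 4 ∧ q = 2))) := by
  subst hvv hd
  decide

/-! ## 3. Non-degeneracy at a value-generic three-Weyl-pair point -/

/-- **NON-DEGENERACY OF THE THREE-PAIR CONFLUENT LIMIT (value-generic).**  Positions: pairs at `0,5`, `1,4`, `2,3`; the three values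
`δ0 0, δ0 1, δ0 2` are VALUE-GENERIC (`hvg`: a coincidence of their pair sums is a coincidence of the pairs — they are distinct and carry no mixed
relation).  If the letters `W` are symmetric and some polar Gram entry is non-zero, the three-pair confluent determinant is not identically zero.
[this work] -/
theorem threePairDet_ne_zero_of_polar_ne_zero (δ0 : Fin 6 → ℝ) (h50 : δ0 5 = δ0 0) (h41 : δ0 4 = δ0 1) (h32 : δ0 3 = δ0 2)
    (hvg : ∀ a b c e : Fin 3, δ0 a.castSucc.castSucc.castSucc + δ0 b.castSucc.castSucc.castSucc
        = δ0 c.castSucc.castSucc.castSucc + δ0 e.castSucc.castSucc.castSucc → (a = c ∧ b = e) ∨ (a = e ∧ b = c))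
    (W : Fin 6 → Matrix (Fin 2) (Fin 2) ℝ) (hWs : ∀ l, (W l).IsSymm) (hW : ∃ p q, polar (W p) (W q) ≠ 0) :
    ∃ t, ((Real.exp (δ0 0 * t)) • (W 0 + t • W 5) + (Real.exp (δ0 1 * t)) • (W 1 + t • W 4)
        + (Real.exp (δ0 2 * t)) • (W 2 + t • W 3)).det ≠ 0 := by
  classical
  by_contra hall
  push Not at hall
  set ρ : Fin 6 → Fin 3 := ![0, 1, 2, 2, 1, 0] with hρdef
  set v : Fin 3 → ℕ := ![0, 1, 3] with hvd
  set vv : Fin 6 → ℕ := ![0, 1, 3, 3, 1, 0] with hvvd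
  set dg : Fin 6 → ℕ := ![0, 0, 0, 1, 1, 1] with hdgdef
  have hρ : ∀ l : Fin 6, δ0 l = δ0 (ρ l).castSucc.castSucc.castSucc := by
    intro l
    fin_cases l
    · rfl
    · rfl
    · rfl
    · exact h32
    · exact h41
    · exact h50
  have hvvρ : ∀ l : Fin 6, vv l = v (ρ l) := by intro l; fin_cases l <;> rfl
  have hmodel := threeVG_model v hvd
  have hv : ∀ p q p₀ q₀ : Fin 6, δ0 p + δ0 q = δ0 p₀ + δ0 q₀ ↔ vv p + vv q = vv p₀ + vv q₀ := by
    intro p q p₀ q₀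
    rw [hρ p, hρ q, hρ p₀, hρ q₀, hvvρ p, hvvρ q, hvvρ p₀, hvvρ q₀, hmodel]
    constructor
    · exact hvg _ _ _ _
    · rintro (⟨ha, hb⟩ | ⟨ha, hb⟩)
      · rw [ha, hb]
      · rw [ha, hb, add_comm]
  have hσ := threePair_classSums_of_det_zero δ0 h50 h41 h32 vv hv dg hdgdef W hall
  -- lonely entries vanish
  have hzero : ∀ p₀ q₀ : Fin 6, ¬ ((p₀ = 0 ∧ q₀ = 4) ∨ (p₀ = 4 ∧ q₀ = 0) ∨ (p₀ = 1 ∧ q₀ = 5) ∨ (p₀ = 5 ∧ q₀ = 1) ∨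
          (p₀ = 0 ∧ q₀ = 3) ∨ (p₀ = 3 ∧ q₀ = 0) ∨ (p₀ = 2 ∧ q₀ = 5) ∨ (p₀ = 5 ∧ q₀ = 2) ∨
          (p₀ = 1 ∧ q₀ = 3) ∨ (p₀ = 3 ∧ q₀ = 1) ∨ (p₀ = 2 ∧ q₀ = 4) ∨ (p₀ = 4 ∧ q₀ = 2)) →
      polar (W p₀) (W q₀) = 0 := by
    intro p₀ q₀ hsp
    refine polar_eq_zero_of_lonely_classSum W p₀ q₀
      (fun p q => (vv p + vv q = vv p₀ + vv q₀ ∧ dg p + dg q = dg p₀ + dg q₀)) ?_ (hσ p₀ q₀)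
    intro p q
    constructor
    · exact fun hk => threePair_lonely vv hvvd dg hdgdef p q p₀ q₀ hk hsp
    · rintro (⟨rfl, rfl⟩ | ⟨rfl, rfl⟩)
      · exact ⟨rfl, rfl⟩
      · exact ⟨add_comm _ _, add_comm _ _⟩
  -- the three special classes
  set x : ℝ := polar (W 0) (W 4) with hx
  set y : ℝ := polar (W 0) (W 3) with hy
  set z : ℝ := polar (W 1) (W 3) with hz
  have hrelx : polar (W 1) (W 5) = -x := by
    have h := hσ 0 4
    simp only [threePair_special04_iff vv hvvd dg hdgdef] at h
    simp [Fin.sum_univ_six] at h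
    linarith [h, polar_comm (W 4) (W 0), polar_comm (W 5) (W 1)]
  have hrely : polar (W 2) (W 5) = -y := by
    have h := hσ 0 3
    simp only [threePair_special03_iff vv hvvd dg hdgdef] at h
    simp [Fin.sum_univ_six] at h
    linarith [h, polar_comm (W 3) (W 0), polar_comm (W 5) (W 2)]
  have hrelz : polar (W 2) (W 4) = -z := by
    have h := hσ 1 3
    simp only [threePair_special13_iff vv hvvd dg hdgdef] at h
    simp [Fin.sum_univ_six] at h
    linarith [h, polar_comm (W 3) (W 1), polar_comm (W 4) (W 2)]
  -- hence every polar Gram entry is a combination of the three disjoint patterns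
  have hentry : ∀ a b : Fin 6, polar (W a) (W b)
      = x * ((if a = 0 ∧ b = 4 then (1 : ℝ) else 0) + (if a = 4 ∧ b = 0 then 1 else 0)
          - (if a = 1 ∧ b = 5 then 1 else 0) - (if a = 5 ∧ b = 1 then 1 else 0))
        + y * ((if a = 0 ∧ b = 3 then (1 : ℝ) else 0) + (if a = 3 ∧ b = 0 then 1 else 0)
          - (if a = 2 ∧ b = 5 then 1 else 0) - (if a = 5 ∧ b = 2 then 1 else 0))
        + z * ((if a = 1 ∧ b = 3 then (1 : ℝ) else 0) + (if a = 3 ∧ b = 1 then 1 else 0)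
          - (if a = 2 ∧ b = 4 then 1 else 0) - (if a = 4 ∧ b = 2 then 1 else 0)) := by
    intro a b
    by_cases hs : (a = 0 ∧ b = 4) ∨ (a = 4 ∧ b = 0) ∨ (a = 1 ∧ b = 5) ∨ (a = 5 ∧ b = 1) ∨
          (a = 0 ∧ b = 3) ∨ (a = 3 ∧ b = 0) ∨ (a = 2 ∧ b = 5) ∨ (a = 5 ∧ b = 2) ∨
          (a = 1 ∧ b = 3) ∨ (a = 3 ∧ b = 1) ∨ (a = 2 ∧ b = 4) ∨ (a = 4 ∧ b = 2)
    · rcases hs with ⟨rfl, rfl⟩ | ⟨rfl, rfl⟩ | ⟨rfl, rfl⟩ | ⟨rfl, rfl⟩ | ⟨rfl, rfl⟩ | ⟨rfl, rfl⟩ | ⟨rfl, rfl⟩ | ⟨rfl, rfl⟩ |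
          ⟨rfl, rfl⟩ | ⟨rfl, rfl⟩ | ⟨rfl, rfl⟩ | ⟨rfl, rfl⟩
      · simpa using hx.symm
      · rw [polar_comm]; simpa using hx.symm
      · simp [hrelx]
      · rw [polar_comm]; simp [hrelx]
      · simpa using hy.symm
      · rw [polar_comm]; simpa using hy.symm
      · simp [hrely]
      · rw [polar_comm]; simp [hrely]
      · simpa using hz.symm
      · rw [polar_comm]; simpa using hz.symm
      · simp [hrelz]
      · rw [polar_comm]; simp [hrelz]
    · rw [hzero a b hs]
      simp only [not_or] at hs
      obtain ⟨h1, h2, h3, h4, h5, h6, h7, h8, h9, h10, h11, h12⟩ := hs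
      rw [if_neg h1, if_neg h2, if_neg h3, if_neg h4, if_neg h5, if_neg h6, if_neg h7, if_neg h8, if_neg h9, if_neg h10, if_neg h11,
        if_neg h12]
      ring
  -- the realisable polar Gram and its block restrictions
  have hG := realisable_polarGram W hWs
  have hB1 : ∀ a : Fin 6, a ∈ ({0, 1, 4, 5} : Finset (Fin 6)) ↔ (a = 0 ∨ a = 1 ∨ a = 4 ∨ a = 5) := by decide
  have hB2 : ∀ a : Fin 6, a ∈ ({0, 2, 3, 5} : Finset (Fin 6)) ↔ (a = 0 ∨ a = 2 ∨ a = 3 ∨ a = 5) := by decide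
  have hB3 : ∀ a : Fin 6, a ∈ ({1, 2, 3, 4} : Finset (Fin 6)) ↔ (a = 1 ∨ a = 2 ∨ a = 3 ∨ a = 4) := by decide
  by_cases hx0 : x ≠ 0
  · have hreal := realisable_blockRestrict_smul hG ({0, 1, 4, 5} : Finset (Fin 6)) x⁻¹
    refine not_realisable_disjointPattern 0 4 1 5 (by decide) (by decide) (by decide) (by decide) (by decide) (by decide) ?_
    convert hreal using 1
    ext a b
    rw [Matrix.of_apply, Matrix.of_apply, Matrix.of_apply]
    by_cases hab : a ∈ ({0, 1, 4, 5} : Finset (Fin 6)) ∧ b ∈ ({0, 1, 4, 5} : Finset (Fin 6))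
    · rw [if_pos hab, hentry a b]
      obtain ⟨ha, hb⟩ := hab
      rw [hB1] at ha hb
      rcases ha with rfl | rfl | rfl | rfl <;> rcases hb with rfl | rfl | rfl | rfl <;> simp [hx0]
    · rw [if_neg hab]
      simp only [not_and_or, hB1, not_or] at hab
      rcases hab with ⟨h1, h2, h3, h4⟩ | ⟨h1, h2, h3, h4⟩
      · simp [h1, h2, h3, h4]
      · simp [h1, h2, h3, h4]
  · push Not at hx0
    by_cases hy0 : y ≠ 0
    · have hreal := realisable_blockRestrict_smul hG ({0, 2, 3, 5} : Finset (Fin 6)) y⁻¹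
      refine not_realisable_disjointPattern 0 3 2 5 (by decide) (by decide) (by decide) (by decide) (by decide) (by decide) ?_
      convert hreal using 1
      ext a b
      rw [Matrix.of_apply, Matrix.of_apply, Matrix.of_apply]
      by_cases hab : a ∈ ({0, 2, 3, 5} : Finset (Fin 6)) ∧ b ∈ ({0, 2, 3, 5} : Finset (Fin 6))
      · rw [if_pos hab, hentry a b, hx0]
        obtain ⟨ha, hb⟩ := hab
        rw [hB2] at ha hb
        rcases ha with rfl | rfl | rfl | rfl <;> rcases hb with rfl | rfl | rfl | rfl <;> simp [hy0]
      · rw [if_neg hab]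
        simp only [not_and_or, hB2, not_or] at hab
        rcases hab with ⟨h1, h2, h3, h4⟩ | ⟨h1, h2, h3, h4⟩
        · simp [h1, h2, h3, h4]
        · simp [h1, h2, h3, h4]
    · push Not at hy0
      by_cases hz0 : z ≠ 0
      · have hreal := realisable_blockRestrict_smul hG ({1, 2, 3, 4} : Finset (Fin 6)) z⁻¹
        refine not_realisable_disjointPattern 1 3 2 4 (by decide) (by decide) (by decide) (by decide) (by decide) (by decide) ?_
        convert hreal using 1
        ext a b
        rw [Matrix.of_apply, Matrix.of_apply, Matrix.of_apply]
        by_cases hab : a ∈ ({1, 2, 3, 4} : Finset (Fin 6)) ∧ b ∈ ({1, 2, 3, 4} : Finset (Fin 6))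
        · rw [if_pos hab, hentry a b, hx0, hy0]
          obtain ⟨ha, hb⟩ := hab
          rw [hB3] at ha hb
          rcases ha with rfl | rfl | rfl | rfl <;> rcases hb with rfl | rfl | rfl | rfl <;> simp [hz0]
        · rw [if_neg hab]
          simp only [not_and_or, hB3, not_or] at hab
          rcases hab with ⟨h1, h2, h3, h4⟩ | ⟨h1, h2, h3, h4⟩
          · simp [h1, h2, h3, h4]
          · simp [h1, h2, h3, h4]
      · push Not at hz0
        obtain ⟨p, q, hpq⟩ := hW
        exact hpq (by rw [hentry p q, hx0, hy0, hz0]; ring)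

end Summit.ValiantsHypothesis.ValiantsHypothesis.Theorems.LacunarySymmetroidMatrixDescartes.WallBubbling
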